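import Summits.MatrixMultiplication.OmegaCensus.SmallFormats.MatMul22nRankGF7Slack6SearchSem2
import Summits.MatrixMultiplication.OmegaCensus.SmallFormats.MatMul22nRankGF7Slack6SearchSplit
import Summits.MatrixMultiplication.OmegaCensus.SmallFormats.MatMul22nRankGF7Slack6WLOG
import Summits.MatrixMultiplication.OmegaCensus.SmallFormats.MatMul22nRankGF7Slack5SearchSound
import HarnessLib

/-!
# ω-census family (a): soundness of the slack-6 search checker K6 — planes of the main check, lane extraction, search induction

Cell `pub-omega` (unit `pub-omega-tensor-g17`), topic `Summits/MatrixMultiplication/OmegaCensus` (sub-folder `SmallFormats`).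
Framing (verbatim): lottery ticket; floor = certified bounds/negative ranges. HONEST FRAMING: kernel infrastructure — the soundness theorem of
`MatMul22nRankGF7Slack6Search` (`pub-omega-tensor-g17/KERNEL-S6-DESIGN.md` §2): if `mainOK6 h = true` for every element `h < 336` and
`searchT6 c = true`, then no LP-tight point of the slack-6 `𝔽₇` X-cap system has torus-0 column `repVal6 c`. The replayed `decide`s and the
assembly are sibling files. Nothing here is progress on `ω`.

* `planeH6_eq`, `keyPlane6_eq`, `freePlane6_eq`, `totPlane6_eq`: the SIMD planes hold, lane by lane, the slot columns, their keys
  `colKey6`, free codes `freeCode6` and the combined 82-bit codes;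
* `lanes6_sound`, `slotOK6_of_main`: the main check delivers `slotOK6` for every slot, level and code;
* `srch6_sound`: induction over the levels `≥ 2` with the invariant 'the state is the packed free vector of the true columns';
* `searchT6_sound`: level 1 (listed classes via `searchT6`, the others via the level-1 branch of `slotOK6`) and the conclusion.
-/

namespace Summit.MatrixMultiplication.OmegaCensus.SmallFormats

open Finset
open Literature.NumberTheory.NumberFields (list_sum_range_map)

set_option exponentiation.threshold 100000

/-! ## The planes of the main check -/

/-- Representative values are 3-bit digits, hence `< 8`. -/
theorem repVal6_lt8 (c z : ℕ) : repVal6 c z < 8 := by unfold repVal6; exact fld3_lt _ _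

/-- The plane of representatives, lane by lane. -/
theorem pid6_eq : pid6 = packW 588 (fun c => packW 14 (repVal6 c) 42) 3692 := by
  unfold pid6 repColQ6 packW
  rw [list_sum_range_map]
  exact sum_congr rfl fun c _ => by rw [list_sum_range_map]

/-- **The plane of element `h`** holds in lane `c` the packed slot column `z ↦ repVal6 c (omAct7 h z)`. -/
theorem planeH6_eq {h : ℕ} (hh : h < 336) : planeH6 h = packW 588 (fun c => packW 14 (fun z => repVal6 c (omAct7 h z)) 42) 3692 := by
  obtain ⟨_, hact⟩ := omAct7_ok ⟨h, hh⟩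
  have hlane : ∀ c < 3692, (fun c => packW 14 (repVal6 c) 42) c < 2 ^ 588 := fun c _ =>
    packW_lt (W := 14) _ 42 fun z _ => lt_trans (repVal6_lt8 c z) (by norm_num)
  unfold planeH6
  rw [← plane_place (fun z c => repVal6 c (omAct7 h z)) 3692]
  refine congrArg List.sum (List.map_congr_left fun z hz => ?_)
  have hz42 := List.mem_range.1 hz
  have ha : omAct7 h z < 42 := (hact ⟨z, hz42⟩).2
  rw [pid6_eq, plane_shift_mask hlane le_rfl (by omega)]
  refine congrArg (· * 2 ^ (14 * z)) (packW_congr 588 fun c _ => ?_)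
  show packW 14 (repVal6 c) 42 >>> (14 * omAct7 h z) % 2 ^ 14 = repVal6 c (omAct7 h z)
  have e : packW 14 (repVal6 c) 42 >>> (14 * omAct7 h z) % 2 ^ 14 = fld 14 (packW 14 (repVal6 c) 42) (omAct7 h z) := by
    rw [fldW_eq, Nat.shiftRight_eq_div_pow]
  rw [e, fld_packW _ (fun i _ => lt_trans (repVal6_lt8 c i) (by norm_num)), if_pos ha]

/-- `plane_dot` with digit bound `6` (slack 6): all 3 692 dot products of the slot columns against a coefficient vector at once. -/
theorem plane_dot6 {p : ℕ → ℕ → ℕ} {n : ℕ} (hp : ∀ c < n, ∀ z < 42, p c z ≤ 6) {l : ℕ → ℕ} (hl : ∀ z < 42, l z ≤ 6) :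
    ((packW 588 (fun c => packW 14 (p c) 42) n * packW 14 (fun j => l (41 - j)) 42) >>> 574) &&& laneMask5 n
      = packW 588 (fun c => ∑ z ∈ range 42, p c z * l z) n := by
  have hp' : ∀ i < 42 * n, (fun i => p (i / 42) (i % 42)) i ≤ 6 :=
    fun i hi => hp _ (by omega) _ (Nat.mod_lt _ (by norm_num))
  have hflat : packW 588 (fun c => packW 14 (p c) 42) n = packW 14 (fun i => p (i / 42) (i % 42)) (42 * n) := packW_nest 14 42 p n
  set conv := convW (fun i => p (i / 42) (i % 42)) (fun j => l (41 - j)) (42 * n) 42 with hconv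
  have hcb : ∀ k, conv k < 2 ^ 14 := fun k =>
    lt_of_le_of_lt (convW_le _ _ (42 * n) 42 k 6 6 hp' (fun j hj => hl _ (by omega))) (by norm_num)
  have hprod : packW 14 (fun i => p (i / 42) (i % 42)) (42 * n) * packW 14 (fun j => l (41 - j)) 42
      = packW 588 (fun c => packW 14 (fun z => conv (42 * c + z)) 42) (n + 1) := by
    have e2 : packW 588 (fun c => packW 14 (fun z => conv (42 * c + z)) 42) (n + 1)
        = packW 14 (fun i => conv (42 * (i / 42) + i % 42)) (42 * (n + 1)) := packW_nest 14 42 (fun c z => conv (42 * c + z)) (n + 1)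
    rw [packW_mul, e2, show 42 * n + 42 = 42 * (n + 1) by ring]
    unfold packW
    exact sum_congr rfl fun i _ => by
      show _ = conv (42 * (i / 42) + i % 42) * _
      rw [Nat.div_add_mod]
  have hlane : ∀ c < n + 1, (fun c => packW 14 (fun z => conv (42 * c + z)) 42) c < 2 ^ 588 :=
    fun c _ => packW_lt (W := 14) (fun z => conv (42 * c + z)) 42 (fun z _ => hcb _)
  rw [hflat, hprod, plane_shift_mask hlane (by omega) (by norm_num)]
  refine packW_congr 588 fun c hc => ?_
  show packW 14 (fun z => conv (42 * c + z)) 42 >>> 574 % 2 ^ 14 = ∑ z ∈ range 42, p c z * l z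
  have e : packW 14 (fun z => conv (42 * c + z)) 42 >>> 574 % 2 ^ 14 = fld 14 (packW 14 (fun z => conv (42 * c + z)) 42) 41 := by
    rw [fldW_eq, Nat.shiftRight_eq_div_pow]
  rw [e, fld_packW _ (fun z _ => hcb _), if_pos (by norm_num), hconv, convW_lane _ l hc]
  exact sum_congr rfl fun z hz => by
    have hz' := mem_range.1 hz
    show p ((42 * c + z) / 42) ((42 * c + z) % 42) * l z = p c z * l z
    rw [show (42 * c + z) / 42 = c by omega, show (42 * c + z) % 42 = z by omega]

/-- **The key plane of a bucket level** holds in lane `c` the key `colKey6` of the slot column `(c, h)`. -/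
theorem keyPlane6_eq {L : ℕ} (_hL : L < 21) (hag : ∀ j < k6Ncr L, ag6 L j = packW 14 (fun k => acoef6 L j (41 - k)) 42 ∧ ∀ z < 42, acoef6 L j z ≤ 6)
    {h : ℕ} (hh : h < 336) :
    keyPlane6 L (planeH6 h) = packW 588 (fun c => colKey6 L (fun z => repVal6 c (omAct7 h z))) 3692 := by
  have hrep := repVal6_le
  unfold keyPlane6 colKey6
  rw [← plane_lincomb (fun j c => (∑ z ∈ range 42, acoef6 L j z * repVal6 c (omAct7 h z)) % 7) (fun j => 7 ^ j) (k6Ncr L) 3692]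
  refine congrArg List.sum (List.map_congr_left fun j hj => ?_)
  have hj' := List.mem_range.1 hj
  obtain ⟨hagj, hal⟩ := hag j hj'
  obtain ⟨_, hact⟩ := omAct7_ok ⟨h, hh⟩
  have hp : ∀ c < 3692, ∀ z < 42, (fun c z => repVal6 c (omAct7 h z)) c z ≤ 6 := fun c hc z hz => by
    show repVal6 c (omAct7 h z) ≤ 6
    exact hrep ⟨c, hc⟩ ⟨omAct7 h z, (hact ⟨z, hz⟩).2⟩
  rw [planeH6_eq hh, hagj, plane_dot6 hp hal]
  have hv : ∀ c < 3692, (fun c => ∑ z ∈ range 42, repVal6 c (omAct7 h z) * acoef6 L j z) c < 2 ^ 14 := by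
    intro c hc
    show ∑ z ∈ range 42, repVal6 c (omAct7 h z) * acoef6 L j z < 2 ^ 14
    calc ∑ z ∈ range 42, repVal6 c (omAct7 h z) * acoef6 L j z ≤ ∑ z ∈ range 42, 6 * 6 :=
          sum_le_sum fun z hz => Nat.mul_le_mul (hp c hc z (mem_range.1 hz)) (hal z (mem_range.1 hz))
      _ < 2 ^ 14 := by simp
  rw [plane_resid hv]
  exact congrArg (· * 7 ^ j) (packW_congr 588 fun c _ => congrArg (· % 7) (sum_congr rfl fun z _ => mul_comm _ _))

/-- **The free-code plane of a bucket level** holds in lane `c` the free code of the slot column `(c, h)`. -/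
theorem freePlane6_eq {L : ℕ} (hL : L < 21) {h : ℕ} (hh : h < 336) :
    freePlane6 L (planeH6 h) = packW 588 (fun c => freeCode6 L (fun z => repVal6 c (omAct7 h z))) 3692 := by
  unfold freePlane6 freeCode6
  have hlane : ∀ c < 3692, (fun c => packW 14 (fun z => repVal6 c (omAct7 h z)) 42) c < 2 ^ 588 := fun c _ =>
    packW_lt (W := 14) _ 42 fun z _ => lt_trans (repVal6_lt8 c _) (by norm_num)
  have e : ∀ k ∈ List.range (k6NFree L), ((planeH6 h >>> (14 * fz6 L k)) &&& laneMask5 3692) * 2 ^ (3 * k)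
      = packW 588 (fun c => repVal6 c (omAct7 h (fz6 L k))) 3692 * 2 ^ (3 * k) := by
    intro k hk
    have hk' := List.mem_range.1 hk
    have hk18 : k < 18 := lt_of_lt_of_le hk' (k6NFree_le L).1
    have hz : fz6 L k < 42 := (fz6_glob' hL hk18 hk').2.2
    rw [planeH6_eq hh, plane_shift_mask hlane le_rfl (by omega)]
    refine congrArg (· * 2 ^ (3 * k)) (packW_congr 588 fun c _ => ?_)
    show packW 14 (fun z => repVal6 c (omAct7 h z)) 42 >>> (14 * fz6 L k) % 2 ^ 14 = repVal6 c (omAct7 h (fz6 L k))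
    have e1 : packW 14 (fun z => repVal6 c (omAct7 h z)) 42 >>> (14 * fz6 L k) % 2 ^ 14
        = fld 14 (packW 14 (fun z => repVal6 c (omAct7 h z)) 42) (fz6 L k) := by rw [fldW_eq, Nat.shiftRight_eq_div_pow]
    rw [e1, fld_packW _ (fun i _ => lt_trans (repVal6_lt8 c _) (by norm_num)), if_pos hz]
  rw [List.map_congr_left e, plane_lincomb (fun k c => repVal6 c (omAct7 h (fz6 L k))) (fun k => 2 ^ (3 * k)) (k6NFree L) 3692]
  rfl

/-- Keys, free codes and codes of slot columns are small. -/
theorem code6_lt {L : ℕ} (hL : L < 21) (hL1 : 1 ≤ L) {h : ℕ} (hh : h < 336) (c : ℕ) (hc : c < 3692) :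
    colKey6 L (fun z => repVal6 c (omAct7 h z)) < 2 ^ 43 ∧ freeCode6 L (fun z => repVal6 c (omAct7 h z)) < 2 ^ 39 := by
  obtain ⟨_, hact⟩ := omAct7_ok ⟨h, hh⟩
  refine ⟨colKey6_lt L hL _, freeCode6_lt hL hL1 fun z hz => ?_⟩
  have hz' : omAct7 h z < 42 := (hact ⟨z, hz⟩).2
  exact repVal6_le ⟨c, hc⟩ ⟨omAct7 h z, hz'⟩

/-- `packW A · k + packW B = packW (A·k + B)`. -/
theorem packW_mul_add (W k : ℕ) (A B : ℕ → ℕ) (n : ℕ) : packW W A n * k + packW W B n = packW W (fun c => A c * k + B c) n := by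
  rw [packW_add, show (fun c => A c * k) = (fun c => k * A c) from funext fun c => mul_comm _ _, packW_smul]; ring

/-- The 82-bit code of a 42-vector at level `L`. -/
def code6 (L : ℕ) (Q : ℕ → ℕ) : ℕ := colKey6 L Q * 2 ^ 39 + freeCode6 L Q

/-- **The total plane of element `h`** holds in lane `c` the seven codes of the slot column `(c, h)`, level `j` in the `82`-bit field `j`. -/
theorem totPlane6_eq (hag : ∀ L < 21, ∀ j < k6Ncr L, ag6 L j = packW 14 (fun k => acoef6 L j (41 - k)) 42 ∧ ∀ z < 42, acoef6 L j z ≤ 6)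
    {h : ℕ} (hh : h < 336) :
    totPlane6 h = packW 588 (fun c => ∑ j ∈ range 7, code6 (bktLev6 j) (fun z => repVal6 c (omAct7 h z)) * 2 ^ (82 * j)) 3692 := by
  unfold totPlane6
  have hbl : ∀ j < 7, bktLev6 j < 21 := by decide
  have e : ∀ j ∈ List.range 7, codePlane6 (bktLev6 j) (planeH6 h) * 2 ^ (82 * j)
      = packW 588 (fun c => code6 (bktLev6 j) (fun z => repVal6 c (omAct7 h z))) 3692 * 2 ^ (82 * j) := by
    intro j hj
    have hj' := List.mem_range.1 hj
    unfold codePlane6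
    rw [keyPlane6_eq (hbl j hj') (hag _ (hbl j hj')) hh, freePlane6_eq (hbl j hj') hh, packW_mul_add]
    rfl
  rw [List.map_congr_left e, plane_lincomb (fun j c => code6 (bktLev6 j) (fun z => repVal6 c (omAct7 h z))) (fun j => 2 ^ (82 * j)) 7 3692]

/-! ## Lane extraction -/

/-- **Unfolding `lanes6`**: if the binary-splitting check passes on a plane of `n` lanes with values `< 2^588`, every lane passes `laneOK6`. -/
theorem lanes6_sound : ∀ fuel c n f, (∀ i < n, f i < 2 ^ 588) → lanes6 fuel c n (packW 588 f n) = true →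
    ∀ i < n, laneOK6 (c + i) (f i) = true := by
  intro fuel
  induction fuel with
  | zero => intro c n f _ hl; simp [lanes6] at hl
  | succ fuel ih =>
    intro c n f hf hl i hi
    unfold lanes6 at hl
    by_cases hn0 : n = 0
    · omega
    rw [if_neg hn0] at hl
    by_cases hn1 : n = 1
    · rw [if_pos hn1] at hl
      subst hn1
      have hi0 : i = 0 := by omega
      subst hi0
      have e : packW 588 f 1 % 2 ^ 588 = f 0 := by
        unfold packW; rw [Finset.sum_range_one, mul_zero, pow_zero, mul_one]; exact Nat.mod_eq_of_lt (hf 0 (by omega))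
      rw [e] at hl; simpa using hl
    rw [if_neg hn1, Bool.and_eq_true] at hl
    obtain ⟨h1, h2⟩ := hl
    rw [packW_and_lanes f (show n / 2 ≤ n by omega) hf] at h1
    rw [packW_shiftRight_lanes f n (n / 2) hf] at h2
    by_cases hlow : i < n / 2
    · exact ih c (n / 2) f (fun j hj => hf j (by omega)) h1 i hlow
    · have h3 := ih (c + n / 2) (n - n / 2) (fun j => f (n / 2 + j)) (fun j hj => hf _ (by omega)) h2 (i - n / 2) (by omega)
      rw [show c + n / 2 + (i - n / 2) = c + i by omega, show n / 2 + (i - n / 2) = i by omega] at h3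
      exact h3

/-- Sums of codes placed in 82-bit fields are `< 2^588`, and their fields can be read back. -/
theorem codes_fields {g : ℕ → ℕ} (hg : ∀ j < 7, g j < 2 ^ 82) :
    ∑ j ∈ range 7, g j * 2 ^ (82 * j) < 2 ^ 588 ∧ ∀ j < 7, (∑ j ∈ range 7, g j * 2 ^ (82 * j)) >>> (82 * j) % 2 ^ 82 = g j := by
  have hp : ∑ j ∈ range 7, g j * 2 ^ (82 * j) = packW 82 g 7 := rfl
  refine ⟨lt_of_lt_of_le (by rw [hp]; exact packW_lt g 7 hg) (Nat.pow_le_pow_right (by norm_num) (by norm_num)), fun j hj => ?_⟩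
  rw [hp, Nat.shiftRight_eq_div_pow, ← fldW_eq, fld_packW g hg, if_pos hj]

/-- **The main check per slot.** If every lane of the total plane of element `h` passes `laneOK6` (`LanesOK6 h 0 3692`, which the
replay certifies in pieces, `MatMul22nRankGF7Slack6SearchSplit`), then for every bucket level index `j < 7` and class `c` the code of
the slot column `(c, h)` at level `bktLev6 j` passes `slotOK6`. -/
theorem slotOK6_of_lanes (hag : ∀ L < 21, ∀ j < k6Ncr L, ag6 L j = packW 14 (fun k => acoef6 L j (41 - k)) 42 ∧ ∀ z < 42, acoef6 L j z ≤ 6)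
    {h : ℕ} (hh : h < 336) (hM : LanesOK6 h 0 3692) {j : ℕ} (hj : j < 7) {c : ℕ} (hc : c < 3692) :
    slotOK6 (bktLev6 j) c (code6 (bktLev6 j) (fun z => repVal6 c (omAct7 h z))) = true := by
  have hbl : ∀ j < 7, bktLev6 j < 21 ∧ 1 ≤ bktLev6 j := by decide
  have hcode : ∀ c < 3692, ∀ j < 7, code6 (bktLev6 j) (fun z => repVal6 c (omAct7 h z)) < 2 ^ 82 := by
    intro c hc j hj
    obtain ⟨hk, hf⟩ := code6_lt (hbl j hj).1 (hbl j hj).2 hh c hc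
    unfold code6
    omega
  have hf : ∀ i < 3692, (fun c => ∑ j ∈ range 7, code6 (bktLev6 j) (fun z => repVal6 c (omAct7 h z)) * 2 ^ (82 * j)) i < 2 ^ 588 :=
    fun i hi => (codes_fields (hcode i hi)).1
  have hlane := hM c (Nat.zero_le _) hc
  rw [totPlane6_eq hag hh, Nat.shiftRight_eq_div_pow, ← fldW_eq, fld_packW _ hf, if_pos hc] at hlane
  unfold laneOK6 at hlane
  have h1 := List.all_eq_true.1 hlane j (List.mem_range.2 hj)
  rwa [(codes_fields (hcode c hc)).2 j hj] at h1

/-- Reading the two fields of a code. -/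
theorem code6_fields {L : ℕ} (hL : L < 21) (hL1 : 1 ≤ L) {Q : ℕ → ℕ} (hQ : ∀ z < 42, Q z ≤ 6) :
    code6 L Q / 2 ^ 39 = colKey6 L Q ∧ code6 L Q % 2 ^ 39 = freeCode6 L Q := by
  have hf := freeCode6_lt hL hL1 hQ
  unfold code6
  constructor
  · rw [Nat.add_comm, Nat.add_mul_div_right _ _ (Nat.two_pow_pos 39), Nat.div_eq_of_lt hf, zero_add]
  · rw [Nat.add_comm, Nat.add_mul_mod_self_right, Nat.mod_eq_of_lt hf]

/-! ## Table consequences of `slotOK6` -/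

/-- Bisection stays inside its window. -/
theorem efind6_ge (L e : ℕ) : ∀ fuel a b, a ≤ efind6 L e fuel a b := by
  intro fuel; induction fuel with
  | zero => intro a b; simp [efind6]
  | succ fuel ih =>
    intro a b; unfold efind6
    split_ifs with h1 h2
    · exact le_rfl
    · exact le_trans (by omega) (ih _ _)
    · exact ih _ _

/-- The bucket of a table key at level `L`: the entries of its range. -/
def bucket6 (L K : ℕ) : Finset ℕ :=
  match lookup6 L K with
  | none => ∅
  | some (s, e) => (range (e - s)).image fun t => ent6 L (s + t)

set_option linter.unusedSimpArgs false in
/-- **Table membership from `slotOK6`** (levels `≥ 2`, and level 1 for listed classes): if the key is a table key then the free code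
is in its bucket. (Key and free code are generalized first, so that no numeral is evaluated.) -/
theorem mem_bucket6_of_slotOK6 {L c code : ℕ} (hs : slotOK6 L c code = true) (hbm : bm6 L (code / 2 ^ 39 % 2 ^ bmb6 L) = 1)
    (htab : ¬ (L = 1 ∧ isTab6 c = false)) {s e : ℕ} (hl : lookup6 L (code / 2 ^ 39) = some (s, e)) :
    code % 2 ^ 39 ∈ bucket6 L (code / 2 ^ 39) := by
  unfold slotOK6 at hs
  generalize code / 2 ^ 39 = key at hs hbm hl ⊢
  generalize code % 2 ^ 39 = ee at hs ⊢
  simp only [hbm, hl, show ((1 : ℕ) == 0) = false from rfl, if_neg htab, Bool.false_or, Bool.and_eq_true, decide_eq_true_eq,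
    beq_iff_eq] at hs
  obtain ⟨hlt, heq⟩ := hs
  unfold bucket6; rw [hl]
  simp only [mem_image, mem_range]
  have hge := efind6_ge L ee 9 s e
  refine ⟨efind6 L ee 9 s e - s, by omega, ?_⟩
  rw [show s + (efind6 L ee 9 s e - s) = efind6 L ee 9 s e by omega]
  exact heq

/-! ## The search is sound -/

/-- Structural facts used by the induction, packaged per level (from `MatMul22nRankGF7Slack6SearchFacts`). -/
structure LevFacts6 (x : ℕ → ℕ) : Prop where
  need : ∀ L < 21, k6IsBkt L = true → needKey6 L (stateW6 x L) = colKey6 L (colN7 x (torOf6 L))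
  det : ∀ L < 21, 1 ≤ L → k6NFree L = 0 → detRes6 L (stateW6 x L) = packW 1752 (colN7 x (torOf6 L)) 42

/-- **Soundness of `srch6` from level 2 on.** At an LP-tight point of slack 6 whose columns are slack-6 patterns, given bucket completeness
for the levels `≥ 2` (from the main check), the search started on the true state of level `L ≥ 2` cannot return `true`. -/
theorem srch6_sound (x : ℕ → ℕ) (hpat : ∀ j < 21, IsPat7 6 (colN7 x j)) (hF : LevFacts6 x)
    (hC : ∀ L < 21, 2 ≤ L → k6IsBkt L = true → ∀ Q : ℕ → ℕ, IsPat7 6 Q →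
      ∀ s e, lookup6 L (colKey6 L Q) = some (s, e) → freeCode6 L Q ∈ bucket6 L (colKey6 L Q)) :
    ∀ fuel L, 2 ≤ L → srch6 fuel L (stateW6 x L) = true → False := by
  have hx : ∀ j < 21, ∀ z < 42, colN7 x j z ≤ 6 := fun j hj z hz => (hpat j hj).1 z hz
  intro fuel
  induction fuel with
  | zero => intro L _ h; simp [srch6] at h
  | succ fuel ih =>
    intro L hL2 h
    rw [srch6] at h
    by_cases h21 : 21 ≤ L
    · rw [if_pos h21] at h; exact Bool.false_ne_true h
    rw [if_neg h21] at h
    have hL : L < 21 := by omega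
    have htor : torOf6 L < 21 := torOf6_lt hL
    by_cases hB : k6IsBkt L = true
    · rw [if_pos hB, hF.need L hL hB] at h
      -- the true column of this level
      set Q := colN7 x (torOf6 L) with hQ
      have hQpat : IsPat7 6 Q := hpat _ htor
      cases hlk : lookup6 L (colKey6 L Q) with
      | none => rw [hlk] at h; exact Bool.false_ne_true h
      | some se =>
        obtain ⟨s, e⟩ := se
        rw [hlk] at h
        simp only [] at h
        have hmem := hC L hL hL2 hB Q hQpat s e hlk
        unfold bucket6 at hmem; rw [hlk] at hmem
        simp only [mem_image, mem_range] at hmem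
        obtain ⟨t, ht, hte⟩ := hmem
        have hchild := List.all_eq_true.1 h t (List.mem_range.2 ht)
        rw [hte, ← stateW6_succ hL (by omega) x hx] at hchild
        exact ih (L + 1) (by omega) hchild
    · rw [if_neg hB] at h
      have hnf : k6NFree L = 0 := by
        have := (lev6_ok' hL).2.2.2.2.2.1
        by_contra hne
        exact hB (this.2 ⟨Nat.pos_of_ne_zero hne, by omega⟩)
      rw [hF.det L hL (by omega) hnf, hepOK6_pat (hpat _ htor)] at h
      simp only [Bool.not_true, Bool.false_or] at h
      rw [← stateW6_det hL hnf] at h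
      exact ih (L + 1) (by omega) h

end Summit.MatrixMultiplication.OmegaCensus.SmallFormats
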